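import Summits.Ventures.PercRepro.RankLevelSetHallEqSplit

/-!
# PercRepro — THE CAPPED-LYM KERNEL AT THE TIGHT LAYER: THE CAP LEMMA, LOADS ≤ 1, AND THE TRANSFER TO THE UP-HALL FORM
(p4, gen 38; paper proofs/P4-CAP-KERNEL.md §1–§2; C-044, UP form, tight layer `#E = p + q`, every `k = p − q ≥ 2`)

For a member `Z` with `F = cl Z` and `d = #(F ∖ Z)`, and a `Y`-set `S ⊇ Z`, let
`m̂_Z(S) := #{T ⊆ S : #T = q, #(T ∖ cl Z) ≤ q − d}` (`capCount`) and give `Z` the weight `1 / m̂_Z(S)` from `S` (`capWeight`).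
**THE CAP LEMMA** (`ncard_sdiff_closure_le_of_mem_cellMembers`, the only matroid fact): every member `Z'` has
`#(Z' ∖ cl Z) ≤ q − d`, because `cl Z ∖ Z'` lies in `E ∖ Z'` (independent) and in the rank-`q` flat `cl Z`, so it has at most `q`
elements.  Hence every member inside `S` is counted by `m̂_Z(S)` (`ncard_eqMembers_le_capCount`), and **every `Y`-set is loaded at
most `1`** (`capWeight_load_le_one`: `m(S)` members, each receiving at most `1/m(S)`) — a member-dependent denominator is
allowed by the double count.  `CapRecv M p q` (a `Prop`: every member receives at least `Φ(p,q)`) gives the UP-Hall condition for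
every family (`hallUp_of_capRecv`).  The point of this kernel (P4-CAP-KERNEL §3): the receipt of `Z` is a `Z`-LOCAL binomial sum
`≥ G(q, k, d)`, so `CapRecv` — and with it the UP-Hall form for every `k` — follows from the purely arithmetic inequality
`G(q, k, d) ≥ Φ(q + k, q)` (`0 ≤ d ≤ q`; verified exactly for `q ≤ 60, k ≤ 12` and `q ≤ 8, k ≤ 40`; `d = 0` equality, `d = 1` and
`k = 2` proved).  The receipt reduction is the next module.

* `capSet`, `capCount`, `capWeight`;
* **`ncard_sdiff_closure_le_of_mem_cellMembers`** (the cap lemma), `mem_capSet_of_mem_eqMembers`, `ncard_eqMembers_le_capCount`;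
* `capWeight_nonneg`, `subset_of_capWeight_ne_zero`, **`capWeight_load_le_one`**;
* `CapRecv`, **`hallUp_of_capRecv`**.
Axioms: standard.
-/

namespace PercRepro

open Set Matroid Finset

variable {α : Type} (M : Matroid α) [M.Finite]

/-- The `q`-subsets of `S` with at most `q − d(Z)` elements outside `cl Z` (`d(Z) = #(cl Z ∖ Z)`). -/
def capSet (q : ℕ) (Z S : Set α) : Set (Set α) :=
  {T | T ⊆ S ∧ T.ncard = q ∧ (T \ M.closure Z).ncard ≤ q - (M.closure Z \ Z).ncard}

/-- `m̂_Z(S) = #capSet q Z S`. -/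
noncomputable def capCount (q : ℕ) (Z S : Set α) : ℕ := (capSet M q Z S).ncard

/-- **The capped-LYM weight** of the member `Z` at the `Y`-set `S`: `1 / m̂_Z(S)` when `Z ⊆ S`, `0` otherwise. -/
noncomputable def capWeight (p q : ℕ) (Z S : Set α) : ℚ := by
  classical
  exact if Z ∈ cellMembers M p q ∧ Z ⊆ S ∧ S ∈ cellY M p q then 1 / ((capCount M q Z S : ℕ) : ℚ) else 0

/-- The cap set of a subset of the ground set is finite. -/
theorem capSet_finite (q : ℕ) (Z S : Set α) (hS : S ⊆ M.E) : (capSet M q Z S).Finite :=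
  (M.set_finite S hS).finite_subsets.subset (fun _ hT => hT.1)

/-- **THE CAP LEMMA**: at the tight layer, for members `Z`, `Z'` of the cell `(p, q)`,
`#(Z' ∖ cl Z) ≤ q − #(cl Z ∖ Z)`. -/
theorem ncard_sdiff_closure_le_of_mem_cellMembers (p q : ℕ) (hE : M.E.ncard = p + q) {Z Z' : Set α}
    (hZ : Z ∈ cellMembers M p q) (hZ' : Z' ∈ cellMembers M p q) :
    (Z' \ M.closure Z).ncard ≤ q - (M.closure Z \ Z).ncard := by
  set F : Set α := M.closure Z with hF
  have hZE : Z ⊆ M.E := hZ.1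
  have hZ'E : Z' ⊆ M.E := hZ'.1
  have hFE : F ⊆ M.E := M.closure_subset_ground Z
  have hEfin : M.E.Finite := M.set_finite M.E
  have hFfin : F.Finite := hEfin.subset hFE
  have hZ'fin : Z'.Finite := hEfin.subset hZ'E
  have hZF : Z ⊆ F := M.subset_closure Z hZE
  -- F ∖ Z' is independent (inside E ∖ Z') and lies in the rank-q flat F
  have hind : M.Indep (F \ Z') :=
    (compl_indep_of_mem_U M hE hZ').1.subset (fun x hx => ⟨hFE hx.1, hx.2⟩)
  have hle : (F \ Z').ncard ≤ q := by
    have h := hind.encard_le_eRk_of_subset (sdiff_subset : F \ Z' ⊆ F)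
    rw [hF, M.eRk_closure_eq, hZ.2.1, ← (hFfin.subset sdiff_subset).cast_ncard_eq] at h
    exact_mod_cast h
  -- the counts
  have hZq : Z.ncard = q := ncard_eq_q_of_mem_cellMembers_tight M hE hZ
  have hZ'q : Z'.ncard = q := ncard_eq_q_of_mem_cellMembers_tight M hE hZ'
  have h1 : (F \ Z).ncard + Z.ncard = F.ncard := ncard_sdiff_add_ncard_of_subset hZF hFfin
  have h2 : (F ∩ Z').ncard + (F \ Z').ncard = F.ncard := ncard_inter_add_ncard_sdiff_eq_ncard F Z' hFfin
  have h3 : (Z' ∩ F).ncard + (Z' \ F).ncard = Z'.ncard := ncard_inter_add_ncard_sdiff_eq_ncard Z' F hZ'fin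
  have h4 : (F ∩ Z').ncard = (Z' ∩ F).ncard := by rw [Set.inter_comm]
  omega

/-- Every member inside `S` lies in the cap set of `Z` (tight layer). -/
theorem mem_capSet_of_mem_eqMembers (p q : ℕ) (hE : M.E.ncard = p + q) {Z Z' S : Set α}
    (hZ : Z ∈ cellMembers M p q) (hZ' : Z' ∈ eqMembers M p q S) : Z' ∈ capSet M q Z S :=
  ⟨hZ'.2, ncard_eq_q_of_mem_cellMembers_tight M hE hZ'.1, ncard_sdiff_closure_le_of_mem_cellMembers M p q hE hZ hZ'.1⟩

/-- `m(S) ≤ m̂_Z(S)`: the members inside `S` number at most the cap count of any member `Z` (tight layer). -/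
theorem ncard_eqMembers_le_capCount (p q : ℕ) (hE : M.E.ncard = p + q) {Z S : Set α} (hZ : Z ∈ cellMembers M p q)
    (hS : S ⊆ M.E) : (eqMembers M p q S).ncard ≤ capCount M q Z S :=
  Set.ncard_le_ncard (fun _ hZ' => mem_capSet_of_mem_eqMembers M p q hE hZ hZ') (capSet_finite M q Z S hS)

omit [M.Finite] in
/-- The weight is non-negative. -/
theorem capWeight_nonneg (p q : ℕ) (Z S : Set α) : 0 ≤ capWeight M p q Z S := by
  classical
  unfold capWeight
  split_ifs <;> positivity

omit [M.Finite] in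
/-- The weight is supported on the pairs `Z ⊆ S`. -/
theorem subset_of_capWeight_ne_zero (p q : ℕ) (Z S : Set α) (h : capWeight M p q Z S ≠ 0) : Z ⊆ S := by
  classical
  by_contra hZS
  apply h
  unfold capWeight
  rw [if_neg (fun hc => hZS hc.2.1)]

/-- **Every `Y`-set is loaded at most `1`** at the tight layer: each of the `m(S)` members inside `S` receives at most
`1/m(S)` (`m(S) ≤ m̂_Z(S)`). -/
theorem capWeight_load_le_one (p q : ℕ) (hE : M.E.ncard = p + q) {S : Set α} (hS : S ∈ cellY M p q) :
    ∑ Z ∈ (cellMembers_finite M p q).toFinset, capWeight M p q Z S ≤ 1 := by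
  classical
  set Mf : Finset (Set α) := (cellMembers_finite M p q).toFinset with hMf
  have hmemM : ∀ Z, Z ∈ Mf ↔ Z ∈ cellMembers M p q := fun Z => by
    rw [hMf, (cellMembers_finite M p q).mem_toFinset]
  -- pointwise: capWeight Z S ≤ eqWeight Z S
  have hpt : ∀ Z ∈ Mf, capWeight M p q Z S ≤ eqWeight M p q Z S := by
    intro Z hZ
    rw [hmemM] at hZ
    unfold capWeight eqWeight
    by_cases hc : Z ∈ cellMembers M p q ∧ Z ⊆ S ∧ S ∈ cellY M p q
    · rw [if_pos hc, if_pos hc]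
      have hm : (0 : ℚ) < ((eqMembers M p q S).ncard : ℚ) := by
        have hne : (eqMembers M p q S).Nonempty := ⟨Z, hZ, hc.2.1⟩
        have := (Set.ncard_pos (eqMembers_finite M p q S)).2 hne
        exact_mod_cast this
      have hle : ((eqMembers M p q S).ncard : ℚ) ≤ ((capCount M q Z S : ℕ) : ℚ) := by
        exact_mod_cast ncard_eqMembers_le_capCount M p q hE hZ hS.1
      exact one_div_le_one_div_of_le hm hle
    · rw [if_neg hc, if_neg hc]
  calc ∑ Z ∈ Mf, capWeight M p q Z S ≤ ∑ Z ∈ Mf, eqWeight M p q Z S := Finset.sum_le_sum hpt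
    _ ≤ 1 := eqWeight_load_le_one M p q hS

/-- **The capped-LYM receipt condition** (a `Prop`): every member receives at least `Φ(p,q)` under the capped-LYM kernel.
By P4-CAP-KERNEL §3 it follows from the binomial inequality `G(q, k, d) ≥ Φ(q+k, q)` (`0 ≤ d ≤ q`, `k = p − q`). -/
def CapRecv (p q : ℕ) : Prop :=
  ∀ Z ∈ cellMembers M p q, phiK p q ≤ ∑ S ∈ (cellY_finite M p q).toFinset, capWeight M p q Z S

/-- **THE TRANSFER**: at the tight layer `#E = p + q`, `CapRecv M p q` gives the UP-Hall condition for every family of members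
(through night-1's `hallUp_of_fracMatching`). -/
theorem hallUp_of_capRecv (p q : ℕ) (hE : M.E.ncard = p + q) (h : CapRecv M p q) (𝒜 : Set (Set α))
    (h𝒜 : 𝒜 ⊆ cellMembers M p q) :
    phiK p q * (𝒜.ncard : ℚ) ≤ ((upNbhd M p q 𝒜).ncard : ℚ) :=
  hallUp_of_fracMatching M p q (capWeight M p q) (capWeight_nonneg M p q) (subset_of_capWeight_ne_zero M p q)
    (fun _ hZ => h _ hZ) (fun _ hS => capWeight_load_le_one M p q hE hS) 𝒜 h𝒜

end PercRepro
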